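import Summits.ValiantsHypothesis.ValiantsHypothesis.Theorems.KPlusLogSqLawTropicalBSplitDefs

/-!
# Route `KPlusLogSqLaw`, crux `TropicalB` — TRANSPOSING a design

HONEST FRAMING.  Helper file toward the registered stubs `stub_tropThin` / `stub_tropFat` of
`Cruxes/TropicalB/Lines/birth.lean` (crux `Summit.ValiantsHypothesis.ValiantsHypothesis.Theses.KPlusLogSqLaw.TropicalB`,
ledger item `stmt-ValiantsHypothesis-19771`, route `KPlusLogSqLaw`, DRAFT; cell `pub-symmetroid`, seat `val-sym-trop-p1`,
2026-08-26).  Nothing here proves any part of a stub; nothing asserts `TropicalB`, `KPlusLogSqLaw`, `MatrixDescartes`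
or anything about `VP ≠ VNP`.

Transposing a tropical design — `vᵀ a b l = v b a l`, `εᵀ a b l = ε b a l`, same exponents — does not change its dominant
chains: the Leibniz term `(σ, λ)` of the transposed design is the term `(σ⁻¹, λ ∘ σ⁻¹)` of the original one, with the
same weight at every slope, the same presence and the SAME sign (`sign σ⁻¹ = sign σ`).  Hence

* `tropWeight_transpose`, `termSign_transpose`, `isDominant_transpose_iff`;
* `designRowD_transpose : DesignRowD d v ε B → DesignRowD d vᵀ εᵀ B` (and back, transposition being an involution:
  `designRowD_of_transpose`);
* `signedChain_transpose` (dominance and sign alternation transport term by term).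

Together with row/column relabeling (…TropicalBRelabel) this generates all support isomorphisms of the census row: e.g.
LOWER Hessenberg designs (`ε a b l ≠ 0 → b ≤ a + 1`) inherit every bound proved for upper Hessenberg ones. [folklore]
-/

set_option linter.dupNamespace false
set_option autoImplicit false

namespace Summit.ValiantsHypothesis.ValiantsHypothesis.Theorems.KPlusLogSqLaw

open Summit.ValiantsHypothesis.ValiantsHypothesis.Theorems.MatrixDescartes.Negative
open Summit.ValiantsHypothesis.ValiantsHypothesis.Theorems.LacunarySymmetroidMatrixDescartes
open Summit.ValiantsHypothesis.ValiantsHypothesis.Theorems.LacunarySymmetroidMatrixDescartes.TropicalCensus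
open scoped BigOperators
open Finset

section Transpose

variable {m K : ℕ} (d : Fin K → ℕ) (v ε : Fin m → Fin m → Fin K → ℤ)

/-- **Weight is invariant under transposition**: the term `(σ⁻¹, λ ∘ σ⁻¹)` of the original design has the weight of
`(σ, λ)` in the transposed design. [folklore] -/
theorem tropWeight_transpose (q : Equiv.Perm (Fin m) × (Fin m → Fin K)) (θ : ℤ) :
    tropWeight d v θ (q.1⁻¹, fun j => q.2 (q.1⁻¹ j)) = tropWeight d (fun a b l => v b a l) θ q := by
  unfold tropWeight
  simp only
  have e1 : ∑ j, (d (q.2 (q.1⁻¹ j)) : ℤ) = ∑ i, (d (q.2 i) : ℤ) :=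
    Fintype.sum_equiv q.1⁻¹ _ _ (fun _ => rfl)
  have e2 : ∑ j, v (q.1⁻¹ j) j (q.2 (q.1⁻¹ j)) = ∑ i, v i (q.1 i) (q.2 i) := by
    refine Fintype.sum_equiv q.1⁻¹ _ _ (fun j => ?_)
    congr 1
    simp
  rw [e1, e2]

/-- **Sign is invariant under transposition** (`sign σ⁻¹ = sign σ`, same entries). [folklore] -/
theorem termSign_transpose (q : Equiv.Perm (Fin m) × (Fin m → Fin K)) :
    termSign ε (q.1⁻¹, fun j => q.2 (q.1⁻¹ j)) = termSign (fun a b l => ε b a l) q := by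
  unfold termSign
  simp only
  have e2 : ∏ j, ε (q.1⁻¹ j) j (q.2 (q.1⁻¹ j)) = ∏ i, ε i (q.1 i) (q.2 i) := by
    refine Fintype.prod_equiv q.1⁻¹ _ _ (fun j => ?_)
    congr 1
    simp
  rw [e2, Equiv.Perm.sign_inv]

/-- the term transport `(σ, λ) ↦ (σ⁻¹, λ ∘ σ⁻¹)` is injective. [folklore] -/
theorem transposeTerm_injective :
    Function.Injective fun q : Equiv.Perm (Fin m) × (Fin m → Fin K) =>
      ((q.1⁻¹ : Equiv.Perm (Fin m)), fun j => q.2 (q.1⁻¹ j)) := by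
  intro q q' h
  simp only [Prod.mk.injEq] at h
  obtain ⟨h1, h2⟩ := h
  have hσ : q.1 = q'.1 := inv_injective h1
  refine Prod.ext hσ (funext fun i => ?_)
  have h3 := congrFun h2 (q.1 i)
  have e1 : q.1⁻¹ (q.1 i) = i := by simp
  have e2 : q'.1⁻¹ (q.1 i) = i := by rw [hσ]; simp
  simp only [e1, e2] at h3
  exact h3

/-- the term transport is an involution up to the obvious identification: `q' = (σ⁻¹, λ∘σ⁻¹)` for `σ = q'.1⁻¹`,
`λ = q'.2 ∘ q'.1⁻¹`. [folklore] -/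
theorem transposeTerm_surjective (q' : Equiv.Perm (Fin m) × (Fin m → Fin K)) :
    ∃ q : Equiv.Perm (Fin m) × (Fin m → Fin K), ((q.1⁻¹ : Equiv.Perm (Fin m)), fun j => q.2 (q.1⁻¹ j)) = q' := by
  refine ⟨(q'.1⁻¹, fun j => q'.2 (q'.1⁻¹ j)), Prod.ext ?_ (funext fun j => ?_)⟩
  · simp
  · simp

/-- **Dominance is invariant under transposition.** [folklore] -/
theorem isDominant_transpose_iff (q : Equiv.Perm (Fin m) × (Fin m → Fin K)) (θ : ℤ) :
    IsDominant d v ε θ (q.1⁻¹, fun j => q.2 (q.1⁻¹ j)) ↔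
      IsDominant d (fun a b l => v b a l) (fun a b l => ε b a l) θ q := by
  constructor
  · rintro ⟨hpres, hdom⟩
    refine ⟨by rwa [termSign_transpose] at hpres, fun q' hq' hq's => ?_⟩
    have hne : ((q'.1⁻¹ : Equiv.Perm (Fin m)), fun j => q'.2 (q'.1⁻¹ j)) ≠
        ((q.1⁻¹ : Equiv.Perm (Fin m)), fun j => q.2 (q.1⁻¹ j)) :=
      fun h => hq' (transposeTerm_injective h)
    have h := hdom _ hne (by rw [termSign_transpose]; exact hq's)
    rwa [tropWeight_transpose, tropWeight_transpose] at h
  · rintro ⟨hpres, hdom⟩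
    refine ⟨by rw [termSign_transpose]; exact hpres, fun qh hqh hqhs => ?_⟩
    obtain ⟨q', rfl⟩ := transposeTerm_surjective qh
    have hne : q' ≠ q := fun h => hqh (by rw [h])
    have h := hdom q' hne (by rw [← termSign_transpose]; exact hqhs)
    rwa [← tropWeight_transpose d v q', ← tropWeight_transpose d v q] at h

/-- **The unsigned row bound is invariant under transposition** (from the design to its transpose). [folklore] -/
theorem designRowD_transpose {B : ℕ} (h : DesignRowD d v ε B) :
    DesignRowD d (fun a b l => v b a l) (fun a b l => ε b a l) B := by
  intro n θ p hθ hdom hne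
  refine h n θ (fun k => (((p k).1⁻¹ : Equiv.Perm (Fin m)), fun j => (p k).2 ((p k).1⁻¹ j))) hθ
    (fun k => (isDominant_transpose_iff d v ε (p k) (θ k)).mpr (hdom k)) (fun k hk => hne k ?_)
  exact transposeTerm_injective hk

/-- **Converse**: a bound for the transposed design is a bound for the design. [folklore] -/
theorem designRowD_of_transpose {B : ℕ} (h : DesignRowD d (fun a b l => v b a l) (fun a b l => ε b a l) B) :
    DesignRowD d v ε B :=
  designRowD_transpose d _ _ h

/-- **Signed chains transport under transposition**: a sign-alternating dominant chain of the transposed design gives one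
of the design with the same slopes, length and signs. [folklore] -/
theorem signedChain_transpose {n : ℕ} (θ : Fin (n + 1) → ℤ)
    (p : Fin (n + 1) → Equiv.Perm (Fin m) × (Fin m → Fin K))
    (hdom : ∀ k, IsDominant d (fun a b l => v b a l) (fun a b l => ε b a l) (θ k) (p k))
    (halt : ∀ k : Fin n, termSign (fun a b l => ε b a l) (p k.castSucc) *
      termSign (fun a b l => ε b a l) (p k.succ) < 0) :
    (∀ k, IsDominant d v ε (θ k) (((p k).1⁻¹ : Equiv.Perm (Fin m)), fun j => (p k).2 ((p k).1⁻¹ j))) ∧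
    (∀ k : Fin n,
      termSign ε (((p k.castSucc).1⁻¹ : Equiv.Perm (Fin m)), fun j => (p k.castSucc).2 ((p k.castSucc).1⁻¹ j)) *
      termSign ε (((p k.succ).1⁻¹ : Equiv.Perm (Fin m)), fun j => (p k.succ).2 ((p k.succ).1⁻¹ j)) < 0) :=
  ⟨fun k => (isDominant_transpose_iff d v ε (p k) (θ k)).mpr (hdom k),
    fun k => by rw [termSign_transpose, termSign_transpose]; exact halt k⟩

end Transpose

end Summit.ValiantsHypothesis.ValiantsHypothesis.Theorems.KPlusLogSqLaw
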